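/-
Copyright (c) 2026 the pub-hodgecm-mathlib formalisation cell (harness21).  Prover seat hodgecm-mathlib-F0P3-p01 (g30), «(D-RAM) FOUR-FRAME» road of crux H413, line LH4, unit U3 §K-R
(dealer LH4-plan (g10) WORDs #44∕#46 «K-ABS-R payer road», census owner's KMS CUT DECISION 2026-09-03T23:05:15Z: the EIGHTFOLD, ω-FREE κ-model sum): the re-cut κ-AMPLITUDE law at a datum
from (NI2) (★ p855402) and the EIGHTFOLD κ-MODEL SUM (KMS), over LH4-p09 (g2)'s ★ κ-weighted eightfold symmetrisation `F0P3cDyRamKappaSumSignClasses`.  2026-09-03∕04.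
-/
import Summits.HodgeConjecture.HodgeConjecture.Theorems.F0P3cDyRamKappaSumSignClasses    -- ★ (LH4-p09 (g2), K-ABS-R second seat): `two_mul_sum_kappaChar_mul_fixedVertexCount_eq_sum_signClasses` (2·Σ_b κ_i(b)·n_t(Γ_b) = Σ_s χ_i(s)·C_t(s)); brings ★ p855115, ★ p855032
import Summits.HodgeConjecture.HodgeConjecture.Theorems.F0P3cDyRamKappaLawOfModelCounts    -- ★ p855506 (this seat): the per-frame reduction; brings ★ №1-R `KappaAmplitudeLawAtS∕AtR`, `shiftR`, ★ №1 `dyadicFence_of`, ★ p855402 `normIndexTwo`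
import HarnessLib

/-!
# F0 · P3c · line LH4 «(D-RAM) FOUR-FRAME» — unit U3 §K-R: THE κ-AMPLITUDE LAW AT A DATUM FROM (NI2) + THE EIGHTFOLD κ-MODEL SUM (KMS, ω-free) — the payer-side plumbing of the
# re-line «K-ABS-R := NI2 ⊕ KMS» (Rogawski 1990 §3.6, §4.9 Prop. 4.9.1 (a); Langlands–Shelstad 1987 §1.3)

Cell `pub/hodgecm-mathlib`, crux H413 = `stmt-HodgeConjecture-24833` (helper lane `--supports stmt-HodgeConjecture-24833 --as helper`), route HCCMUnconditional; THEOREMS ONLY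
(no definition, no instance, no notation, no named fact, no `sorry`, no `set_option` beyond `autoImplicit false`; default heartbeats).

WHAT IS PROVED.  For any schedule `shift`, threshold `N₀`, type shift `τ` and datum `(K, σ, ϖ, d, t)`: if (NI2) some `σ`-fixed unit `c` satisfies the index-two dichotomy and (KMS — EIGHTFOLD,
ω-FREE) for every such `c`, every element datum `(α, β; n₁, n₂, n₃)` at `N₀ d`, `T = diag(α, β, 1)`, every `k` with `2k + d = Σn + 2`, every `i` and parity datum `2B = n_i − d + 2 − 2·shift d t`:
  `|Σ_{s : Fin 3 → Bool} χ⁰_i(s) · C₀(s)| = 2·ampl q k B`  and  `|Σ_s χ⁰_i(s) · C₂(s)| = 2·ampl q k (B + τ d)`,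
with `C_t(s) = #{M : M a type-t vertex lattice of (K³, diag(d_s)), T·M = M}` (`d_s j = c` if `s j` else `1`) and the ω-FREE characters `χ⁰_0(s) = sgn(s 1)·sgn(s 2)`, `χ⁰_1(s) = sgn(s 0)·sgn(s 2)`,
`χ⁰_2(s) = sgn(s 0)·sgn(s 1)` (`sgn b = −1` if `b` else `1`) — THEN `KappaAmplitudeLawAtS shift N₀ τ σ ϖ d t` (★ №1-R §S verbatim): `kappaAmplitudeLawAtS_of_normIndexTwo_of_kappaModelSum8`.
At `(shiftR, depthOfRecord, tauOfRecord)` with (NI2) DISCHARGED by ★ `normIndexTwo`:  **`dyadicFence_kappaAmplitudeLawAtR_of_kappaModelSum8 (σ ϖ d t) (hKMS) :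
DyadicFence (KappaAmplitudeLawAtR depthOfRecord tauOfRecord σ ϖ d t)`** — the conclusion of `U3_Laws.stub_U3_kappaAbsLawR` at the datum from the ONE frame-free, ω-free binder (KMS),
whose index set `s : Fin 3 → Bool` is the MS road's own ((S-fin) bricks are per-`s`).  Nothing is claimed about (KMS): it is a BINDER (a census law in model currency — a PROVER TARGET).

THE MATHEMATICS.  ★ LH4-p09's bridge gives `2·Σ_b κ_i(b)·n_t(Γ_b) = Σ_s χ_i(s)·C_t(s)` with `χ_i(s) = w^{[i ≠ 2]}·χ⁰_i(s)`, `w = normSign σ (−1) ∈ {±1}` (★ p855115 `normSign_eq_one_or`) a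
GLOBAL sign: `Σ_s χ_i(s)·C_t(s) = w_i · Σ_s χ⁰_i(s)·C_t(s)` (`chiSum_eq_unitSign_mul_chiSum`), so `2·|Σ_b κ_i(b)·n_t(Γ_b)| = |Σ_s χ⁰_i(s)·C_t(s)|` (`two_mul_abs_kappaSum_eq_abs_chiSum`) and the eightfold
(KMS) halves to ★ №1-R's κ-amplitude clause.  `T = diag(α, β, 1) ∈ GL₃` from the element datum (`α·σα = β·σβ = 1`) as in ★ p855240.

* §1 `chiSum_eq_unitSign_mul_chiSum`, `two_mul_abs_kappaSum_eq_abs_chiSum`.   §2 **`kappaAmplitudeLawAtS_of_normIndexTwo_of_kappaModelSum8`**, `dyadicFence_kappaAmplitudeLawAtS_of_normIndexTwo_of_kappaModelSum8`,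
  **`dyadicFence_kappaAmplitudeLawAtR_of_kappaModelSum8`**.

HONEST LABEL: HC_CM is proved only modulo the 7 printed citations (2 remaining named inputs: hLiu418 = stmt-HodgeConjecture-24832, h413 = stmt-HodgeConjecture-24833) until
rung 0 closes; count-neutral (`--supports`); (KMS) is a census law — empirical (κ-amplitude rows of record 520∕520 + the RC-1 re-cut, in range at `d < t` only at e3b∕e3a4), a PROVER
TARGET, never a literature fact; the verdict of record for (D-RAM) stays PRINT [LanglandsShelstad1989 Thm. p. 484 ∕ Rogawski1990 Prop. 4.9.1 (a)].

## References
* [Rogawski1990] J. D. Rogawski, *Automorphic Representations of Unitary Groups in Three Variables*, Ann. of Math. Stud. 123 (1990), §3.6 pp. 28–29, §4.9 Prop. 4.9.1 (a) p. 55, §12.2.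
* [LanglandsShelstad1987] R. P. Langlands, D. Shelstad, *On the definition of transfer factors*, Math. Ann. 278 (1987), §1.3 (the κ-signs of the classes in a stable class).
* [Jacobowitz1962] R. Jacobowitz, *Hermitian forms over local fields*, Amer. J. Math. 84 (1962), §4.
-/

set_option autoImplicit false

noncomputable section

namespace Summit.HodgeConjecture.HodgeConjecture.Cruxes.H413.F0P3cDyRamKappaAbsLawOfKappaModelSum

open Matrix
open Literature.NumberTheory.Automorphic Literature.NumberTheory.Automorphic.HermitianLattice Literature.NumberTheory.Automorphic.UnitaryGroup
open Literature.NumberTheory.Automorphic.UnitaryLatticeTree Literature.NumberTheory.Automorphic.UnitaryThreeFourFrame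
open Summit.HodgeConjecture.HodgeConjecture.Cruxes.H413.F0P3cDyRamStableSumSignClasses
open Summit.HodgeConjecture.HodgeConjecture.Cruxes.H413.F0P3cDyRamKappaSumSignClasses
open Summit.HodgeConjecture.HodgeConjecture.Cruxes.H413.F0P3cDyRamFourFrameLawDefs
open Summit.HodgeConjecture.HodgeConjecture.Cruxes.H413.F0P3cDyRamFourFrameLawDefsR
open Summit.HodgeConjecture.HodgeConjecture.Cruxes.H413.F0P3cDyRamNormIndexTwo
open scoped Valued WithZero Matrix MatrixGroups

/-! ## §1 The class of `−1` is a global sign of the κ-characters: `Σ_s χ_i(s)·C(s) = w_i · Σ_s χ⁰_i(s)·C(s)`, hence `2·|Σ_b κ_i(b)·n_t(Γ_b)| = |Σ_s χ⁰_i(s)·C_t(s)|` -/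

section Sign

variable {K : Type} [Field K] [Valued K ℤᵐ⁰] {σ : K →+* K} {ϖ : K}

/-- `Σ_s χ_i(s)·C(s) = w_i · Σ_s χ⁰_i(s)·C(s)` for ANY weights `C` and any integer `w` (`w_0 = w_1 = w`, `w_2 = 1`): the factor `w` of ★ LH4-p09's characters `χ_0, χ_1` is global.
[cite: LanglandsShelstad1987, §1.3] -/
theorem chiSum_eq_unitSign_mul_chiSum (w : ℤ) (C : (Fin 3 → Bool) → ℤ) (i : Fin 3) :
    ∑ s : Fin 3 → Bool,
        (![(if s 1 then -1 else 1) * (if s 2 then -1 else 1) * w,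
           (if s 0 then -1 else 1) * (if s 2 then -1 else 1) * w,
           (if s 0 then -1 else 1) * (if s 1 then -1 else 1)] : Fin 3 → ℤ) i * C s =
      (![w, w, 1] : Fin 3 → ℤ) i *
        ∑ s : Fin 3 → Bool,
          (![(if s 1 then -1 else 1) * (if s 2 then -1 else 1),
             (if s 0 then -1 else 1) * (if s 2 then -1 else 1),
             (if s 0 then -1 else 1) * (if s 1 then -1 else 1)] : Fin 3 → ℤ) i * C s := by
  rw [Finset.mul_sum]
  refine Finset.sum_congr rfl fun s _ => ?_
  fin_cases i <;> simp

/-- **`2·|Σ_b κ_i(b)·n_t(Γ_b)| = |Σ_s χ⁰_i(s)·C_t(s)|`** (over `ℚ`): ★ LH4-p09's eightfold symmetrisation, the global sign `w = normSign σ (−1) ∈ {±1}` (★ `normSign_eq_one_or`) removed by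
the absolute value. [cite: Rogawski1990, §3.6 pp. 28–29; §4.9 Prop. 4.9.1 (a) p. 55] [cite: LanglandsShelstad1987, §1.3] -/
theorem two_mul_abs_kappaSum_eq_abs_chiSum (hσ : ∀ x, σ (σ x) = x) (hvσ : ∀ a, Valued.v (σ a) = Valued.v a)
    (hϖ : Valued.v ϖ = WithZero.exp (-1 : ℤ)) (heven : ∀ x : K, σ x = x → x ≠ 0 → ∃ n : ℤ, Valued.v x = WithZero.exp (2 * n))
    {c : K} (hσc : σ c = c) (hvc : Valued.v c = 1)
    (hdich : ∀ x : K, σ x = x → x ≠ 0 → (∃ z : K, z * σ z = x) ∨ ∃ z : K, z * σ z = c * x)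
    {f : Fin 4 → Fin 3 → (Fin 3 → K)} (hf : IsFourFrameFamily σ f) (α β : K)
    (T : GL (Fin 3) K) (hT : (T : Matrix (Fin 3) (Fin 3) K) = Matrix.diagonal ![α, β, 1])
    (Γ : Fin 4 → GL (Fin 3) K) (hΓ : ∀ b, (Γ b : Matrix (Fin 3) (Fin 3) K) = frameElt σ f b α β) (t : ℕ) (i : Fin 3) :
    2 * |((∑ b : Fin 4, kappaChar i b * (fixedVertexCount σ ϖ t (Γ b) : ℤ) : ℤ) : ℚ)| =
      |((∑ s : Fin 3 → Bool,
          (![(if s 1 then -1 else 1) * (if s 2 then -1 else 1),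
             (if s 0 then -1 else 1) * (if s 2 then -1 else 1),
             (if s 0 then -1 else 1) * (if s 1 then -1 else 1)] : Fin 3 → ℤ) i *
            ({M : Submodule 𝒪[K] (Fin 3 → K) |
              IsVertexLattice σ ϖ (Matrix.diagonal fun j => if s j then c else (1 : K)) t M ∧ mapGL T M = M}.ncard : ℤ) : ℤ) : ℚ)| := by
  have hbridge := two_mul_sum_kappaChar_mul_fixedVertexCount_eq_sum_signClasses hσ hvσ hϖ heven hσc hvc hdich hf α β T hT Γ hΓ t i
  rw [chiSum_eq_unitSign_mul_chiSum] at hbridge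
  -- `|w_i| = 1`
  have hw : |(((![normSign σ (-1 : K), normSign σ (-1 : K), 1] : Fin 3 → ℤ) i : ℤ) : ℚ)| = 1 := by
    rcases normSign_eq_one_or σ (-1 : K) with h | h <;> rw [h] <;> fin_cases i <;> simp
  have hq : (2 : ℚ) * ((∑ b : Fin 4, kappaChar i b * (fixedVertexCount σ ϖ t (Γ b) : ℤ) : ℤ) : ℚ) =
      (((![normSign σ (-1 : K), normSign σ (-1 : K), 1] : Fin 3 → ℤ) i : ℤ) : ℚ) *
        ((∑ s : Fin 3 → Bool,
          (![(if s 1 then -1 else 1) * (if s 2 then -1 else 1),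
             (if s 0 then -1 else 1) * (if s 2 then -1 else 1),
             (if s 0 then -1 else 1) * (if s 1 then -1 else 1)] : Fin 3 → ℤ) i *
            ({M : Submodule 𝒪[K] (Fin 3 → K) |
              IsVertexLattice σ ϖ (Matrix.diagonal fun j => if s j then c else (1 : K)) t M ∧ mapGL T M = M}.ncard : ℤ) : ℤ) : ℚ) := by
    exact_mod_cast hbridge
  have h2 : (2 : ℚ) * |((∑ b : Fin 4, kappaChar i b * (fixedVertexCount σ ϖ t (Γ b) : ℤ) : ℤ) : ℚ)| =
      |(2 : ℚ) * ((∑ b : Fin 4, kappaChar i b * (fixedVertexCount σ ϖ t (Γ b) : ℤ) : ℤ) : ℚ)| := by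
    rw [abs_mul, abs_two]
  rw [h2, hq, abs_mul, hw, one_mul]

end Sign

/-! ## §2 The κ-amplitude law at a datum from (NI2) + the eightfold (KMS); the record instance with (NI2) discharged by ★ `normIndexTwo` -/

section Reduction

variable {K : Type} [Field K] [Valued K ℤᵐ⁰] [CompleteSpace K] [Fintype 𝓀[K]]

/-- **THE κ-AMPLITUDE LAW AT A DATUM FROM (NI2) + THE EIGHTFOLD, ω-FREE κ-MODEL SUM (KMS)** (any schedule `shift`, threshold `N₀`, type shift `τ`): `KappaAmplitudeLawAtS shift N₀ τ σ ϖ d t`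
(★ №1-R §S verbatim) follows from a `σ`-fixed unit `c` with the index-two dichotomy (NI2) and (KMS): for every such `c`, element datum at `N₀ d`, `T = diag(α, β, 1)`, `2k + d = Σn + 2`, `i`,
`2B = n_i − d + 2 − 2·shift d t`: `|Σ_s χ⁰_i(s)·C₀(s)| = 2·ampl q k B ∧ |Σ_s χ⁰_i(s)·C₂(s)| = 2·ampl q k (B + τ d)` — by §1 and halving. [cite: Rogawski1990, §4.9 Prop. 4.9.1 (a) p. 55]
[cite: LanglandsShelstad1987, §1.3] -/
theorem kappaAmplitudeLawAtS_of_normIndexTwo_of_kappaModelSum8 (shift : ℕ → ℕ → ℤ) (N₀ : ℕ → ℕ) (τ : ℕ → ℤ) (σ : K →+* K) (ϖ : K) (d t : ℕ)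
    (hNI : ∃ c : K, σ c = c ∧ Valued.v c = 1 ∧ ∀ x : K, σ x = x → x ≠ 0 → (∃ z : K, z * σ z = x) ∨ ∃ z : K, z * σ z = c * x)
    (hKMS : ∀ c : K, σ c = c → Valued.v c = 1 → (∀ x : K, σ x = x → x ≠ 0 → (∃ z : K, z * σ z = x) ∨ ∃ z : K, z * σ z = c * x) →
      ∀ (α β : K) (n₁ n₂ n₃ : ℕ), IsElementDatum σ ϖ (N₀ d) α β n₁ n₂ n₃ →
      ∀ (T : GL (Fin 3) K), (T : Matrix (Fin 3) (Fin 3) K) = Matrix.diagonal ![α, β, 1] →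
      ∀ (k : ℕ), 2 * k + d = n₁ + n₂ + n₃ + 2 →
      ∀ (i : Fin 3) (B : ℤ), 2 * B = ((![n₁, n₂, n₃] : Fin 3 → ℕ) i : ℤ) - d + 2 - 2 * shift d t →
        |((∑ s : Fin 3 → Bool,
            (![(if s 1 then -1 else 1) * (if s 2 then -1 else 1),
               (if s 0 then -1 else 1) * (if s 2 then -1 else 1),
               (if s 0 then -1 else 1) * (if s 1 then -1 else 1)] : Fin 3 → ℤ) i *
              ({M : Submodule 𝒪[K] (Fin 3 → K) |
                IsVertexLattice σ ϖ (Matrix.diagonal fun j => if s j then c else (1 : K)) 0 M ∧ mapGL T M = M}.ncard : ℤ) : ℤ) : ℚ)| =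
          2 * ampl (Fintype.card 𝓀[K]) k B ∧
        |((∑ s : Fin 3 → Bool,
            (![(if s 1 then -1 else 1) * (if s 2 then -1 else 1),
               (if s 0 then -1 else 1) * (if s 2 then -1 else 1),
               (if s 0 then -1 else 1) * (if s 1 then -1 else 1)] : Fin 3 → ℤ) i *
              ({M : Submodule 𝒪[K] (Fin 3 → K) |
                IsVertexLattice σ ϖ (Matrix.diagonal fun j => if s j then c else (1 : K)) 2 M ∧ mapGL T M = M}.ncard : ℤ) : ℤ) : ℚ)| =
          2 * ampl (Fintype.card 𝓀[K]) k (B + τ d)) :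
    KappaAmplitudeLawAtS shift N₀ τ σ ϖ d t := by
  intro hD f hf α β n₁ n₂ n₃ hE Γ hΓ k hk i B hB
  obtain ⟨hσ, hvσ, hϖ, heven, -, -, -⟩ := hD
  obtain ⟨c, hσc, hvc, hdich⟩ := hNI
  -- `α, β` are units (`α·σα = 1`)
  have hα0 : α ≠ 0 := fun h => by have h1 := hE.1; rw [h, zero_mul] at h1; exact zero_ne_one h1
  have hβ0 : β ≠ 0 := fun h => by have h1 := hE.2.1; rw [h, zero_mul] at h1; exact zero_ne_one h1
  -- the diagonal literal `T = diag(α, β, 1)` as a `GL₃` element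
  let T : GL (Fin 3) K :=
    ⟨Matrix.diagonal ![α, β, 1], Matrix.diagonal ![α⁻¹, β⁻¹, 1],
      by rw [Matrix.diagonal_mul_diagonal, ← Matrix.diagonal_one]; congr 1; funext j; fin_cases j <;> simp [hα0, hβ0],
      by rw [Matrix.diagonal_mul_diagonal, ← Matrix.diagonal_one]; congr 1; funext j; fin_cases j <;> simp [hα0, hβ0]⟩
  have hT : (T : Matrix (Fin 3) (Fin 3) K) = Matrix.diagonal ![α, β, 1] := rfl
  obtain ⟨hK0, hK2⟩ := hKMS c hσc hvc hdich α β n₁ n₂ n₃ hE T hT k hk i B hB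
  have h0 := two_mul_abs_kappaSum_eq_abs_chiSum hσ hvσ hϖ heven hσc hvc hdich hf α β T hT Γ hΓ 0 i
  have h2 := two_mul_abs_kappaSum_eq_abs_chiSum hσ hvσ hϖ heven hσc hvc hdich hf α β T hT Γ hΓ 2 i
  rw [hK0] at h0
  rw [hK2] at h2
  constructor
  · linarith
  · linarith

/-- **THE FENCED FORM**: `DyadicFence (KappaAmplitudeLawAtS shift N₀ τ σ ϖ d t)` from (NI2) + the eightfold (KMS) (★ №1 `dyadicFence_of`). [cite: Rogawski1990, §4.9 Prop. 4.9.1 (a) p. 55] -/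
theorem dyadicFence_kappaAmplitudeLawAtS_of_normIndexTwo_of_kappaModelSum8 (shift : ℕ → ℕ → ℤ) (N₀ : ℕ → ℕ) (τ : ℕ → ℤ) (σ : K →+* K) (ϖ : K) (d t : ℕ)
    (hNI : ∃ c : K, σ c = c ∧ Valued.v c = 1 ∧ ∀ x : K, σ x = x → x ≠ 0 → (∃ z : K, z * σ z = x) ∨ ∃ z : K, z * σ z = c * x)
    (hKMS : ∀ c : K, σ c = c → Valued.v c = 1 → (∀ x : K, σ x = x → x ≠ 0 → (∃ z : K, z * σ z = x) ∨ ∃ z : K, z * σ z = c * x) →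
      ∀ (α β : K) (n₁ n₂ n₃ : ℕ), IsElementDatum σ ϖ (N₀ d) α β n₁ n₂ n₃ →
      ∀ (T : GL (Fin 3) K), (T : Matrix (Fin 3) (Fin 3) K) = Matrix.diagonal ![α, β, 1] →
      ∀ (k : ℕ), 2 * k + d = n₁ + n₂ + n₃ + 2 →
      ∀ (i : Fin 3) (B : ℤ), 2 * B = ((![n₁, n₂, n₃] : Fin 3 → ℕ) i : ℤ) - d + 2 - 2 * shift d t →
        |((∑ s : Fin 3 → Bool,
            (![(if s 1 then -1 else 1) * (if s 2 then -1 else 1),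
               (if s 0 then -1 else 1) * (if s 2 then -1 else 1),
               (if s 0 then -1 else 1) * (if s 1 then -1 else 1)] : Fin 3 → ℤ) i *
              ({M : Submodule 𝒪[K] (Fin 3 → K) |
                IsVertexLattice σ ϖ (Matrix.diagonal fun j => if s j then c else (1 : K)) 0 M ∧ mapGL T M = M}.ncard : ℤ) : ℤ) : ℚ)| =
          2 * ampl (Fintype.card 𝓀[K]) k B ∧
        |((∑ s : Fin 3 → Bool,
            (![(if s 1 then -1 else 1) * (if s 2 then -1 else 1),
               (if s 0 then -1 else 1) * (if s 2 then -1 else 1),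
               (if s 0 then -1 else 1) * (if s 1 then -1 else 1)] : Fin 3 → ℤ) i *
              ({M : Submodule 𝒪[K] (Fin 3 → K) |
                IsVertexLattice σ ϖ (Matrix.diagonal fun j => if s j then c else (1 : K)) 2 M ∧ mapGL T M = M}.ncard : ℤ) : ℤ) : ℚ)| =
          2 * ampl (Fintype.card 𝓀[K]) k (B + τ d)) :
    DyadicFence (K := K) (KappaAmplitudeLawAtS shift N₀ τ σ ϖ d t) :=
  dyadicFence_of (kappaAmplitudeLawAtS_of_normIndexTwo_of_kappaModelSum8 shift N₀ τ σ ϖ d t hNI hKMS)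

/-- **THE RECORD INSTANCE WITH (NI2) DISCHARGED — the conclusion of `U3_Laws.stub_U3_kappaAbsLawR` at the datum from the eightfold (KMS) alone**: at `(shiftR, depthOfRecord, tauOfRecord)`,
(KMS) implies `DyadicFence (KappaAmplitudeLawAtR depthOfRecord tauOfRecord σ ϖ d t)`; (NI2) is ★ `normIndexTwo`.  The assembly a later U3 edition can write for the FENCED + DATUM-GUARDED
stub (REF5 R5-39 (1)): `stub_U3_kappaAbsLawR := fun σ ϖ d t h2 hD => kappaAmplitudeLawAtS_of_normIndexTwo_of_kappaModelSum8 shiftR depthOfRecord tauOfRecord σ ϖ d t (normIndexTwo σ ϖ d t hD)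
(stub_U3_kappaModelSum σ ϖ d t h2 hD) hD`. [cite: Rogawski1990, §4.9 Prop. 4.9.1 (a) p. 55] [cite: LanglandsShelstad1987, §1.3] -/
theorem dyadicFence_kappaAmplitudeLawAtR_of_kappaModelSum8 (σ : K →+* K) (ϖ : K) (d t : ℕ)
    (hKMS : ∀ c : K, σ c = c → Valued.v c = 1 → (∀ x : K, σ x = x → x ≠ 0 → (∃ z : K, z * σ z = x) ∨ ∃ z : K, z * σ z = c * x) →
      ∀ (α β : K) (n₁ n₂ n₃ : ℕ), IsElementDatum σ ϖ (depthOfRecord d) α β n₁ n₂ n₃ →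
      ∀ (T : GL (Fin 3) K), (T : Matrix (Fin 3) (Fin 3) K) = Matrix.diagonal ![α, β, 1] →
      ∀ (k : ℕ), 2 * k + d = n₁ + n₂ + n₃ + 2 →
      ∀ (i : Fin 3) (B : ℤ), 2 * B = ((![n₁, n₂, n₃] : Fin 3 → ℕ) i : ℤ) - d + 2 - 2 * shiftR d t →
        |((∑ s : Fin 3 → Bool,
            (![(if s 1 then -1 else 1) * (if s 2 then -1 else 1),
               (if s 0 then -1 else 1) * (if s 2 then -1 else 1),
               (if s 0 then -1 else 1) * (if s 1 then -1 else 1)] : Fin 3 → ℤ) i *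
              ({M : Submodule 𝒪[K] (Fin 3 → K) |
                IsVertexLattice σ ϖ (Matrix.diagonal fun j => if s j then c else (1 : K)) 0 M ∧ mapGL T M = M}.ncard : ℤ) : ℤ) : ℚ)| =
          2 * ampl (Fintype.card 𝓀[K]) k B ∧
        |((∑ s : Fin 3 → Bool,
            (![(if s 1 then -1 else 1) * (if s 2 then -1 else 1),
               (if s 0 then -1 else 1) * (if s 2 then -1 else 1),
               (if s 0 then -1 else 1) * (if s 1 then -1 else 1)] : Fin 3 → ℤ) i *
              ({M : Submodule 𝒪[K] (Fin 3 → K) |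
                IsVertexLattice σ ϖ (Matrix.diagonal fun j => if s j then c else (1 : K)) 2 M ∧ mapGL T M = M}.ncard : ℤ) : ℤ) : ℚ)| =
          2 * ampl (Fintype.card 𝓀[K]) k (B + tauOfRecord d)) :
    DyadicFence (K := K) (KappaAmplitudeLawAtR depthOfRecord tauOfRecord σ ϖ d t) := by
  intro _ hD
  exact kappaAmplitudeLawAtS_of_normIndexTwo_of_kappaModelSum8 shiftR depthOfRecord tauOfRecord σ ϖ d t (normIndexTwo σ ϖ d t hD) hKMS hD

end Reduction

end Summit.HodgeConjecture.HodgeConjecture.Cruxes.H413.F0P3cDyRamKappaAbsLawOfKappaModelSum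

end
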